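import Summits.BirchSwinnertonDyer.BirchSwinnertonDyer.Theorems.KatoDescentPotSupersingularWildFineSelmerLayerOneL5Records09
import Summits.BirchSwinnertonDyer.BirchSwinnertonDyer.Theorems.KatoDescentPotSupersingularWildFineSelmerStabilizerFukudaRecords01
import Summits.BirchSwinnertonDyer.BirchSwinnertonDyer.Theorems.KatoDescentPotSupersingularWildUpperUnitTwistRecordsClassO601
import Summits.BirchSwinnertonDyer.BirchSwinnertonDyer.Theorems.KatoDescentPotSupersingularWildUpperUnitTwistRecordsClassO602
import Summits.BirchSwinnertonDyer.BirchSwinnertonDyer.Theorems.KatoDescentPotSupersingularWildUpperUnitTwistRecordsClassO606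
import Summits.BirchSwinnertonDyer.BirchSwinnertonDyer.Theorems.KatoDescentPotSupersingularWildUpperUnitTwistRecordsClassO612
import Summits.BirchSwinnertonDyer.BirchSwinnertonDyer.Theorems.KatoDescentPotSupersingularWildUpperUnitTwistRecordsClassO625
import Summits.BirchSwinnertonDyer.BirchSwinnertonDyer.Theorems.KatoDescentPotSupersingularWildUpperUnitTwistRecordsFlat17
import Summits.BirchSwinnertonDyer.BirchSwinnertonDyer.Theorems.KatoDescentPotSupersingularWildUpperUnitTwistRecordsFlat30
import Summits.BirchSwinnertonDyer.BirchSwinnertonDyer.Theorems.KatoDescentPotSupersingularWildUpperUnitTwistRecordsSharp10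
import Summits.BirchSwinnertonDyer.BirchSwinnertonDyer.Theorems.KatoDescentPotSupersingularWildUpperUnitTwistRecordsSharpP10
import Summits.BirchSwinnertonDyer.BirchSwinnertonDyer.Theorems.KatoDescentPotSupersingularWildUpperUnitTwistRecordsSharpP26
import Summits.BirchSwinnertonDyer.BirchSwinnertonDyer.Theorems.KatoDescentPotSupersingularWildUpperUnitTwistRecordsSharpP27
import HarnessLib

/-!
# Route `KatoDescentPotSupersingular` (rung K9, sub-rung B5 = O6 wild `p = 3`, cell `bsd-potss`): per-row records on the FACT-FREE door L8.3 — FUKUDA'S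
# TWO-LAYER RANK TEST at the torsion-point field `ℚ(P)` (octic) — statement (A) of Coates–Sujatha at `(E, 3)` with NO named fact, and U₀ modulo
# `hKatoA hGZK hmod`, parts 02–03: the 14 `3Nn` rows of the K9 U₀-ns table whose every earlier fact-free (A) record reads a degree-48 field under GRH
# (k9-c4 g27 GRH-axis census): 99846j1, 114075cn1/cr1/cu1, 181629r1, 292032gn1, 382347dr1/x1, 465696dr1, 475200ea1, 477603bt1, 487350fs1/fv1, 499392dk1
# — THIS FILE = part 02: §0 the door + rows 99846j1, 114075cn1/cr1/cu1, 181629r1, 292032gn1; part 03 = the other eight (seat `bsd-potss-k9-c4` g27; `--supports stmt-BirchSwinnertonDyer-19197 --as helper`)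

HONEST FRAMING. THEOREMS ONLY (no definition, no named fact, no `sorry`); PER ROW — NOT a class theorem; nothing is booked; items 19189 / 19197 / 19942 /
19386 stay OPEN at class level (class-wide: 24327 / 19200 / 19191 unchanged); Conjecture A and BSD are proved for NO class of curves.  Each theorem is CONDITIONAL
on ONE displayed numerical hypothesis about ONE octic number field `ℚ(P)` and its first cyclotomic layer `ℚ(P)₁` (degree 24) — a `3`-RANK equality of class
groups, computed by PARI/GP (kit j336045; `ℚ(P)` CERTIFIED by `bnfcertify`, `ℚ(P)₁` under GRH: a 3-hour `bnfcertify` attempt per field did not finish) — and on NO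
named fact for (A); the U₀ twins display the usual `hKatoA hGZK hmod` + Cremona's `r_an = 0`.
WHY THESE ROWS, WHY THIS DOOR (k9-c4 g27 GRH axis, census `K9-GRH-AXIS-g27.tsv`): before this file the only fact-free (A)@3 records of these 14 rows were the Fukuda
`(0,1)` test on `L = ℚ(E[3])` (degree 16 / layer 48, `…FukudaRecordsNoF`, `ρ̄ ∈ Cl(L)/3` so door L6 is silent) and, for 114075c*, door L5 at layer 1 (degree 48) — class
groups of degree-48 fields under GRH, beyond any certification engine of the cell.  Door L8.3 of conjA-anchor g19
(`CoatesSujatha2005.conjA_of_classGroupPRank_stabilizerField_succ_eq`, Literature `FineSelmerTorsionPointFieldMuRoad`, a KERNEL theorem: Fukuda 1994 Thm. 1 (2) at finite level on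
`ℚ(P)` ⟹ `μ₃(ℚ(P)_cyc) = 0` ⟹ bounded ranks ⟹ (A) via the torsion-point-field descent, Coates–Sujatha 3.4 + Lemma 3.8) reads instead the OCTIC `ℚ(P) = ℚ̄^{Stab(P)}` and its
degree-24 layer: `E[3]` irreducible (kernel `irr_g…_3`) and `Δ(E)` a CUBE (kernel) ⟹ `ρ̄_{E,3}` not onto ⟹ `3 ∤ #Gal(ℚ(E[3])/ℚ)` ⟹ tameness AND Fukuda index `0` for every cyclotomic
`ℤ₃`-extension of `ℚ(P)` (`CartanMuRoadFukudaDoorsTprime.totallyRamifiedFrom_zero_of_isCyclotomic_of_algHom_normal_of_not_dvd_card`) — all in the KERNEL; displayed: the rank equality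
`hrk`.  NUMERICS (kit j336045, PARI/GP 2.17.3, scripts `run/shared/lean/pub/bsd-potss/k9-c4/g27/kit/jobQP14/`, RESULT file `…/k9-c4/g27/kit/results/RESULT-QP14-j336045.txt`): on
ALL 14 rows `rank₃ Cl(ℚ(P)₁) = rank₃ Cl(ℚ(P))` (= `1`, resp. `0` on 114075c*), `ℚ(P)` certified, `ℚ(P)₁` GRH; the ORDER test (door L8.2, part 01's shape) holds on 8 of them
and fails on 181629r1, 382347dr1/x1, 475200ea1, 487350fs1/fv1, so the RANK form is used uniformly.  The identification of the Lean field `fixedField (Stab P)` with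
`ℚ[x]/(octic)` is the census memos' (all `ℚ(P)`, `P ≠ 0`, are conjugate under the `3Nn` image), not a kernel statement; the `3Nn` image itself is the cell census' label
(conjA-anchor g15), the kernel uses only `irr` + `Δ` cube.
KERNEL lemmas `isElliptic_g…`, `isGloballyMinimal_g…`, `irr_g…_3` (`…WildUpperUnitTwistRecords{Flat,Sharp,SharpP}NN`), `classO6_g…_3` (`…ClassO6NN`) and `Δ_cube_g114075c*`
(`…LayerOneL5Records09`) are IMPORTED; the remaining `Δ_cube_g…` are proved in parts 02/03 (`norm_num`).

References: [CoatesSujatha2005] Thm. 3.4, Lemma 3.8; [Fukuda1994] Thm. 1 (2), p. 264; [Washington1997] §13.3 Lemma 13.18, Prop. 13.22–13.23; [NeukirchANT1999] Ch. IV §6,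
Ch. VI §7 Thm. (7.1); [Serre1972] §2.4 Prop. 15, §5.3; [Kato2004Asterisque] Thm. 14.5 (3), Prop. 14.16 (2); [Cremona2006] Table 1.
-/

set_option autoImplicit false
set_option linter.dupNamespace false

noncomputable section

open scoped Classical NumberField
open WeierstrassCurve NumberField Field IsDedekindDomain IntermediateField
  Literature.NumberTheory.EllipticCurves Literature.NumberTheory.EllipticCurves.Rank1Residual
  Literature.NumberTheory.EllipticCurves.Rank1Residual.Typed
  Literature.NumberTheory.GaloisRepresentations Literature.NumberTheory.NumberFields
  Literature.NumberTheory.SerreUniformity Literature.NumberTheory.IwasawaTheory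
  Summit.BirchSwinnertonDyer.Rank1Residual Summit.BirchSwinnertonDyer.Rank1Residual.Additive
  Summit.BirchSwinnertonDyer.BirchSwinnertonDyer.Theorems
  Summit.BirchSwinnertonDyer.BirchSwinnertonDyer.Theorems.AdditiveBranchIMCGordTwoRankOne
  Summit.BirchSwinnertonDyer.BirchSwinnertonDyer.Theorems.WildUpperUnitTwistRecords

namespace Summit.BirchSwinnertonDyer.BirchSwinnertonDyer.Theorems.WildFineSelmerStabilizerFukudaRecords

/-! ## §0 The road (door L8.3 with Fukuda's RANK test; Fukuda's index and tameness from `Δ` a cube) -/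

set_option synthInstance.maxHeartbeats 400000 in
set_option maxHeartbeats 4000000 in
/-- **(A) at `(W, 3)` from ONE `3`-rank equality on the torsion-point field's tower** (fact-free road of this file): `W/ℚ` elliptic, `W[3]` irreducible, `Δ(W)` a cube
(so `ρ̄_{W,3}` is not onto and `3 ∤ #Gal(ℚ(W[3])/ℚ)`: Fukuda index `0` at `ℚ(P) ⊆ ℚ(W[3])` and tameness, all kernel), `P ∈ W[3] ∖ 0`; DISPLAYED: for every cyclotomic
`ℤ₃`-extension `κ_P` of `ℚ(P) = ℚ̄^{Stab(P)}`, `rank₃ Cl(ℚ(P)_{n+1}) = rank₃ Cl(ℚ(P)_n)`.  Then statement (A) holds for `W` at `3` over every cyclotomic `ℤ₃`-extension of `ℚ`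
(door L8.3 `CoatesSujatha2005.conjA_of_classGroupPRank_stabilizerField_succ_eq`: Fukuda Thm. 1 (2) at finite level ⟹ `μ = 0` ⟹ bounded ranks ⟹ Coates–Sujatha (A) via the
torsion-point-field descent). [cite: CoatesSujatha2005, §3 Thm. 3.4 and Lemma 3.8] [cite: Fukuda1994, Thm. 1 (2), p. 264]
[cite: Washington1997, §13.3 Lemma 13.18 and Prop. 13.22] [cite: Serre1972, §2.4 Prop. 15, §5.3] [cite: NeukirchANT1999, Ch. IV §6 and Ch. VI §7 Thm. (7.1)] -/
theorem conjA_three_of_Δ_eq_cube_of_classGroupPRank_stabilizerField_succ_eq (W : WeierstrassCurve ℚ) [W.IsElliptic]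
    (hirr : W.HasIrreducibleModPGaloisRep 3) {d : ℚ} (hΔ : W.Δ = d ^ 3)
    (P : ↥(W.geomTorsion ((3 : ℕ) : ℤ))) (hP0 : P ≠ 0) (n : ℕ)
    (hrk : ∀ κP : ZpExtension ↥(fixedField (MulAction.stabilizer (absoluteGaloisGroup ℚ) P) :
        IntermediateField ℚ (AlgebraicClosure ℚ)) 3, κP.IsCyclotomic →
        classGroupPRank κP (n + 1) = classGroupPRank κP n)
    (κ : ZpExtension ℚ 3) (hκ : κ.IsCyclotomic) :
    ∃ (γ : absoluteGaloisGroup ℚ) (Df : W.FineSelmerDualData κ γ),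
      Module.Finite ℤ_[3] (RestrictScalars ℤ_[3] (IwasawaAlgebra 3) Df.X) := by
  haveI : Fact (Nat.Prime 3) := ⟨Nat.prime_three⟩
  have hns : ¬ W.HasSurjectiveModNGaloisRep 3 := ModThreeImage.not_hasSurjectiveModNGaloisRep_three_of_Δ_eq_cube W hΔ
  have hG : ¬ 3 ∣ Nat.card ((W.divisionField 3) ≃ₐ[ℚ] (W.divisionField 3)) :=
    SmallImageDickson.not_dvd_card_aut_divisionField W 3 hirr hns
  have hle : fixedField (MulAction.stabilizer (absoluteGaloisGroup ℚ) P) ≤ W.divisionField 3 :=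
    CoatesSujatha2005.fixedField_stabilizer_le_divisionField W P
  haveI : FiniteDimensional ℚ ↥(W.divisionField 3) := W.finiteDimensional_divisionField 3
  haveI : IsGalois ℚ ↥(W.divisionField 3) := W.isGalois_divisionField 3
  haveI : FiniteDimensional ℚ ↥(fixedField (MulAction.stabilizer (absoluteGaloisGroup ℚ) P)) :=
    FiniteDimensional.of_injective (IntermediateField.inclusion hle).toLinearMap (IntermediateField.inclusion_injective hle)
  haveI : NumberField ↥(fixedField (MulAction.stabilizer (absoluteGaloisGroup ℚ) P)) := NumberField.mk
  exact CoatesSujatha2005.conjA_of_classGroupPRank_stabilizerField_succ_eq W (by decide) hirr hG P hP0 n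
    (fun κP hκP => CartanMuRoadFukudaDoorsTprime.totallyRamifiedFrom_zero_of_isCyclotomic_of_algHom_normal_of_not_dvd_card
      ↥(fixedField (MulAction.stabilizer (absoluteGaloisGroup ℚ) P)) (W.divisionField 3) 3 hG (IntermediateField.inclusion hle) κP hκP)
    hrk κ hκ

set_option synthInstance.maxHeartbeats 400000 in
set_option maxHeartbeats 4000000 in
/-- **U₀ `ord₃ #Ш(W) ≤ ord₃ #Ш(W)_an` from the same datum** (modulo the named facts `hKatoA` (Kato's fine-Selmer reading of 14.5 (3)), `hGZK`, `hmod`, and Cremona's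
`r_an = 0`): `W/ℚ` minimal, `ClassO6 W 3`, `W[3]` irreducible, `Δ(W)` a cube, `P ≠ 0`, and the displayed two-layer `3`-rank equality at `ℚ(P)` — then `MissingUpperBoundAt W 3`
(k8t-c4's `WildFineSelmerSupersingularCMAnchor.missingUpperBoundAt_wild_of_conjA` over the (A)-door above). CONDITIONAL; nothing booked; BSD proved for no curve.
[cite: Kato2004Asterisque, Thm. 14.5 (3) (p. 236) and Prop. 14.16 (2)] [cite: CoatesSujatha2005, §3 Thm. 3.4] [cite: Fukuda1994, Thm. 1 (2), p. 264] [cite: Serre1972, §2.4 Prop. 15, §5.3] -/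
theorem missingUpperBoundAt_three_of_Δ_eq_cube_of_classGroupPRank_stabilizerField_succ_eq
    (hKatoA : Kato2004.rankZero_padicValNat_sha_add_padicValNat_tamagawa_le_of_additive_potGood_of_irreducible_of_fineSelmerDual_fg)
    (hGZK : rank_eq_analyticRank_of_analyticRank_le_one) (hmod : hasEntireLFunction_rat)
    (W : WeierstrassCurve ℚ) [W.IsElliptic] [W.IsGloballyMinimal] (hr : W.analyticRank = 0) (hO : ClassO6 W 3)
    (hirr : W.HasIrreducibleModPGaloisRep 3) {d : ℚ} (hΔ : W.Δ = d ^ 3)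
    (P : ↥(W.geomTorsion ((3 : ℕ) : ℤ))) (hP0 : P ≠ 0) (n : ℕ)
    (hrk : ∀ κP : ZpExtension ↥(fixedField (MulAction.stabilizer (absoluteGaloisGroup ℚ) P) :
        IntermediateField ℚ (AlgebraicClosure ℚ)) 3, κP.IsCyclotomic →
        classGroupPRank κP (n + 1) = classGroupPRank κP n) :
    MissingUpperBoundAt W 3 := by
  haveI : Fact (Nat.Prime 3) := ⟨Nat.prime_three⟩
  exact WildFineSelmerSupersingularCMAnchor.missingUpperBoundAt_wild_of_conjA hKatoA hGZK hmod W hr hO hirr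
    (fun κ hκ => conjA_three_of_Δ_eq_cube_of_classGroupPRank_stabilizerField_succ_eq W hirr hΔ P hP0 n hrk κ hκ)

/-! ## §1 The rows -/

/-! ### `99846j1` @ `p = 3` — `N = 99846 = 2·3^3·43^2`; Cremona: `r_an = 0`; O6 wild at `3`; image `3Nn` (census); `Δ = (-4293378)³`; torsion-point field
`ℚ(P) ≅ ℚ[x]/(x^8 - 2*x^7 + x^6 - 32*x^5 + 28*x^4 + 4*x^3 + 127*x^2 - 194*x - 125)` (octic, kit j336045 rebuilt from `ψ₃`; `h = 3`, `Cl ≅ [3]`, `bnfcertify = 1`: CERTIFIED; primes above `3` `[e,f] = [[8, 1]]`);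
first cyclotomic layer `ℚ(P)₁ = ℚ(P)·ℚ(ζ₉)⁺` (degree 24; kit j336045, GRH: `h = 3`, `Cl ≅ [3]`, primes above `3` `[[24, 1]]`; `bnfcertify` NOT finished in the 3 h cap):
`rank₃ Cl(ℚ(P)) = 1` (CERT) `= 1 = rank₃ Cl(ℚ(P)₁)` (GRH) — Fukuda's RANK test holds at `(0,1)` (the ORDER test too: `ord₃ h` 1 = 1).
Earlier fact-free (A) roads of this row all read a degree-48 field `L₁ = ℚ(E[3])·ℚ(ζ₉)⁺` under GRH (`…FukudaRecordsNoF`); this record reads degree 8 (certified) + degree 24 (GRH). -/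
/-- `Δ(99846j1) = (-4293378)³` — a CUBE (kernel, `norm_num`). [cite: Serre1972, §5.3] [cite: Cremona2006, Table 1 (Cremona label 99846j1)] -/
theorem Δ_cube_g99846j1 : (⟨1, (-1), 1, 670840, 371947411⟩ : WeierstrassCurve ℚ).Δ = (((-4293378) : ℚ)) ^ 3 := by
  norm_num [WeierstrassCurve.Δ, WeierstrassCurve.b₂, WeierstrassCurve.b₄, WeierstrassCurve.b₆, WeierstrassCurve.b₈]

/-- **(A) AT `(99846j1, 3)` — NO NAMED FACT** (door L8.3, Fukuda RANK test at `ℚ(P)`, layers `(0,1)`): KERNEL `irr_g99846j1_3`, `Δ_cube_g99846j1`; DISPLAYED `hrk`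
(«`rank₃ Cl(ℚ(P)₁) = rank₃ Cl(ℚ(P))`», every `P ≠ 0`, every cyclotomic `κ_P`; kit j336045: `Cl(ℚ(P)) ≅ [3]` CERTIFIED, `Cl(ℚ(P)₁) ≅ [3]` GRH, ranks `1 = 1`).
Per row; CONDITIONAL on the displayed datum; nothing booked; (A)/BSD proved for no class. [cite: CoatesSujatha2005, §3 Thm. 3.4 and Lemma 3.8] [cite: Fukuda1994, Thm. 1 (2), p. 264]
[cite: Serre1972, §2.4 Prop. 15, §5.3] [cite: Cremona2006, Table 1 (Cremona label 99846j1)] -/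
theorem conjA_g99846j1_3_L8r
    {W : WeierstrassCurve ℚ} [W.IsElliptic] (hWeq : W = (⟨1, (-1), 1, 670840, 371947411⟩ : WeierstrassCurve ℚ))
    (P : ↥(W.geomTorsion ((3 : ℕ) : ℤ))) (hP0 : P ≠ 0)
    (hrk : ∀ κP : ZpExtension ↥(fixedField (MulAction.stabilizer (absoluteGaloisGroup ℚ) P) :
        IntermediateField ℚ (AlgebraicClosure ℚ)) 3, κP.IsCyclotomic →
        classGroupPRank κP (0 + 1) = classGroupPRank κP 0)
    (κ : ZpExtension ℚ 3) (hκ : κ.IsCyclotomic) :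
    ∃ (γ : absoluteGaloisGroup ℚ) (Df : W.FineSelmerDualData κ γ),
      Module.Finite ℤ_[3] (RestrictScalars ℤ_[3] (IwasawaAlgebra 3) Df.X) := by
  subst hWeq
  exact conjA_three_of_Δ_eq_cube_of_classGroupPRank_stabilizerField_succ_eq _ irr_g99846j1_3 Δ_cube_g99846j1 P hP0 0 hrk κ hκ

/-- **RECORD — U₀ `ord₃ #Ш(E) ≤ ord₃ #Ш(E)_an` for `E = 99846j1` at `p = 3` on the fact-free door L8.3 / Fukuda RANK test at `ℚ(P)`** (U₀-ns row of K9 items 19189 / 19197):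
KERNEL `classO6_g99846j1_3`, `irr_g99846j1_3`, `Δ_cube_g99846j1`; DISPLAYED named facts `hKatoA hGZK hmod` ONLY, Cremona's `r_an = 0` (`hr`), and `hrk` (kit j336045:
`Cl(ℚ(P)) ≅ [3]` CERT, `Cl(ℚ(P)₁) ≅ [3]` GRH). Per row; nothing booked; BSD is not proved by this.
[cite: Kato2004Asterisque, Thm. 14.5 (3) (p. 236) and Prop. 14.16 (2)] [cite: CoatesSujatha2005, §3 Thm. 3.4] [cite: Fukuda1994, Thm. 1 (2), p. 264]
[cite: Cremona2006, Table 1 (Cremona label 99846j1)] -/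
theorem missingUpperBoundAt_g99846j1_3_L8r
    (hKatoA : Kato2004.rankZero_padicValNat_sha_add_padicValNat_tamagawa_le_of_additive_potGood_of_irreducible_of_fineSelmerDual_fg)
    (hGZK : rank_eq_analyticRank_of_analyticRank_le_one) (hmod : hasEntireLFunction_rat)
    {W : WeierstrassCurve ℚ} [W.IsElliptic] [W.IsGloballyMinimal] (hWeq : W = (⟨1, (-1), 1, 670840, 371947411⟩ : WeierstrassCurve ℚ))
    (hr : W.analyticRank = 0) (P : ↥(W.geomTorsion ((3 : ℕ) : ℤ))) (hP0 : P ≠ 0)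
    (hrk : ∀ κP : ZpExtension ↥(fixedField (MulAction.stabilizer (absoluteGaloisGroup ℚ) P) :
        IntermediateField ℚ (AlgebraicClosure ℚ)) 3, κP.IsCyclotomic →
        classGroupPRank κP (0 + 1) = classGroupPRank κP 0) :
    MissingUpperBoundAt W 3 := by
  subst hWeq
  exact missingUpperBoundAt_three_of_Δ_eq_cube_of_classGroupPRank_stabilizerField_succ_eq hKatoA hGZK hmod _ hr classO6_g99846j1_3 irr_g99846j1_3
    Δ_cube_g99846j1 P hP0 0 hrk

/-! ### `114075cn1` @ `p = 3` — `N = 114075 = 3^3·5^2·13^2`; Cremona: `r_an = 0`; O6 wild at `3`; image `3Nn` (census); `Δ = (-296595)³`; torsion-point field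
`ℚ(P) ≅ ℚ[x]/(x^8 - 12*x^6 - 65*x^5 - 141*x^4 - 195*x^3 - 108*x^2 + 81)` (octic, kit j336045 rebuilt from `ψ₃`; `h = 4`, `Cl ≅ [4]`, `bnfcertify = 1`: CERTIFIED; primes above `3` `[e,f] = [[1, 1], [2, 1], [2, 1], [2, 1], [1, 1]]`);
first cyclotomic layer `ℚ(P)₁ = ℚ(P)·ℚ(ζ₉)⁺` (degree 24; kit j336045, GRH: `h = 4`, `Cl ≅ [4]`, primes above `3` `[[3, 1], [6, 1], [6, 1], [6, 1], [3, 1]]`; `bnfcertify` NOT finished in the 3 h cap):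
`rank₃ Cl(ℚ(P)) = 0` (CERT) `= 0 = rank₃ Cl(ℚ(P)₁)` (GRH) — Fukuda's RANK test holds at `(0,1)` (the ORDER test too: `ord₃ h` 0 = 0).
Earlier fact-free (A) roads of this row all read a degree-48 field `L₁ = ℚ(E[3])·ℚ(ζ₉)⁺` under GRH (`…FukudaRecordsNoF`, `…LayerOneL5Records09`); this record reads degree 8 (certified) + degree 24 (GRH). -/
/-- **(A) AT `(114075cn1, 3)` — NO NAMED FACT** (door L8.3, Fukuda RANK test at `ℚ(P)`, layers `(0,1)`): KERNEL `irr_g114075cn1_3`, `Δ_cube_g114075cn1`; DISPLAYED `hrk`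
(«`rank₃ Cl(ℚ(P)₁) = rank₃ Cl(ℚ(P))`», every `P ≠ 0`, every cyclotomic `κ_P`; kit j336045: `Cl(ℚ(P)) ≅ [4]` CERTIFIED, `Cl(ℚ(P)₁) ≅ [4]` GRH, ranks `0 = 0`).
Per row; CONDITIONAL on the displayed datum; nothing booked; (A)/BSD proved for no class. [cite: CoatesSujatha2005, §3 Thm. 3.4 and Lemma 3.8] [cite: Fukuda1994, Thm. 1 (2), p. 264]
[cite: Serre1972, §2.4 Prop. 15, §5.3] [cite: Cremona2006, Table 1 (Cremona label 114075cn1)] -/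
theorem conjA_g114075cn1_3_L8r
    {W : WeierstrassCurve ℚ} [W.IsElliptic] (hWeq : W = (⟨1, (-1), 0, (-18537), 7836596⟩ : WeierstrassCurve ℚ))
    (P : ↥(W.geomTorsion ((3 : ℕ) : ℤ))) (hP0 : P ≠ 0)
    (hrk : ∀ κP : ZpExtension ↥(fixedField (MulAction.stabilizer (absoluteGaloisGroup ℚ) P) :
        IntermediateField ℚ (AlgebraicClosure ℚ)) 3, κP.IsCyclotomic →
        classGroupPRank κP (0 + 1) = classGroupPRank κP 0)
    (κ : ZpExtension ℚ 3) (hκ : κ.IsCyclotomic) :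
    ∃ (γ : absoluteGaloisGroup ℚ) (Df : W.FineSelmerDualData κ γ),
      Module.Finite ℤ_[3] (RestrictScalars ℤ_[3] (IwasawaAlgebra 3) Df.X) := by
  subst hWeq
  exact conjA_three_of_Δ_eq_cube_of_classGroupPRank_stabilizerField_succ_eq _ irr_g114075cn1_3 WildFineSelmerLayerOneL5Records.Δ_cube_g114075cn1 P hP0 0 hrk κ hκ

/-- **RECORD — U₀ `ord₃ #Ш(E) ≤ ord₃ #Ш(E)_an` for `E = 114075cn1` at `p = 3` on the fact-free door L8.3 / Fukuda RANK test at `ℚ(P)`** (U₀-ns row of K9 items 19189 / 19197):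
KERNEL `classO6_g114075cn1_3`, `irr_g114075cn1_3`, `Δ_cube_g114075cn1`; DISPLAYED named facts `hKatoA hGZK hmod` ONLY, Cremona's `r_an = 0` (`hr`), and `hrk` (kit j336045:
`Cl(ℚ(P)) ≅ [4]` CERT, `Cl(ℚ(P)₁) ≅ [4]` GRH). Per row; nothing booked; BSD is not proved by this.
[cite: Kato2004Asterisque, Thm. 14.5 (3) (p. 236) and Prop. 14.16 (2)] [cite: CoatesSujatha2005, §3 Thm. 3.4] [cite: Fukuda1994, Thm. 1 (2), p. 264]
[cite: Cremona2006, Table 1 (Cremona label 114075cn1)] -/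
theorem missingUpperBoundAt_g114075cn1_3_L8r
    (hKatoA : Kato2004.rankZero_padicValNat_sha_add_padicValNat_tamagawa_le_of_additive_potGood_of_irreducible_of_fineSelmerDual_fg)
    (hGZK : rank_eq_analyticRank_of_analyticRank_le_one) (hmod : hasEntireLFunction_rat)
    {W : WeierstrassCurve ℚ} [W.IsElliptic] [W.IsGloballyMinimal] (hWeq : W = (⟨1, (-1), 0, (-18537), 7836596⟩ : WeierstrassCurve ℚ))
    (hr : W.analyticRank = 0) (P : ↥(W.geomTorsion ((3 : ℕ) : ℤ))) (hP0 : P ≠ 0)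
    (hrk : ∀ κP : ZpExtension ↥(fixedField (MulAction.stabilizer (absoluteGaloisGroup ℚ) P) :
        IntermediateField ℚ (AlgebraicClosure ℚ)) 3, κP.IsCyclotomic →
        classGroupPRank κP (0 + 1) = classGroupPRank κP 0) :
    MissingUpperBoundAt W 3 := by
  subst hWeq
  exact missingUpperBoundAt_three_of_Δ_eq_cube_of_classGroupPRank_stabilizerField_succ_eq hKatoA hGZK hmod _ hr classO6_g114075cn1_3 irr_g114075cn1_3
    WildFineSelmerLayerOneL5Records.Δ_cube_g114075cn1 P hP0 0 hrk

/-! ### `114075cr1` @ `p = 3` — `N = 114075 = 3^3·5^2·13^2`; Cremona: `r_an = 0`; O6 wild at `3`; image `3Nn` (census); `Δ = (-1755)³`; torsion-point field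
`ℚ(P) ≅ ℚ[x]/(x^8 - 12*x^6 - 65*x^5 - 141*x^4 - 195*x^3 - 108*x^2 + 81)` (octic, kit j336045 rebuilt from `ψ₃`; `h = 4`, `Cl ≅ [4]`, `bnfcertify = 1`: CERTIFIED; primes above `3` `[e,f] = [[1, 1], [2, 1], [2, 1], [2, 1], [1, 1]]`);
first cyclotomic layer `ℚ(P)₁ = ℚ(P)·ℚ(ζ₉)⁺` (degree 24; kit j336045, GRH: `h = 4`, `Cl ≅ [4]`, primes above `3` `[[3, 1], [6, 1], [6, 1], [6, 1], [3, 1]]`; `bnfcertify` NOT finished in the 3 h cap):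
`rank₃ Cl(ℚ(P)) = 0` (CERT) `= 0 = rank₃ Cl(ℚ(P)₁)` (GRH) — Fukuda's RANK test holds at `(0,1)` (the ORDER test too: `ord₃ h` 0 = 0).
Earlier fact-free (A) roads of this row all read a degree-48 field `L₁ = ℚ(E[3])·ℚ(ζ₉)⁺` under GRH (`…FukudaRecordsNoF`, `…LayerOneL5Records09`); this record reads degree 8 (certified) + degree 24 (GRH). -/
/-- **(A) AT `(114075cr1, 3)` — NO NAMED FACT** (door L8.3, Fukuda RANK test at `ℚ(P)`, layers `(0,1)`): KERNEL `irr_g114075cr1_3`, `Δ_cube_g114075cr1`; DISPLAYED `hrk`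
(«`rank₃ Cl(ℚ(P)₁) = rank₃ Cl(ℚ(P))`», every `P ≠ 0`, every cyclotomic `κ_P`; kit j336045: `Cl(ℚ(P)) ≅ [4]` CERTIFIED, `Cl(ℚ(P)₁) ≅ [4]` GRH, ranks `0 = 0`).
Per row; CONDITIONAL on the displayed datum; nothing booked; (A)/BSD proved for no class. [cite: CoatesSujatha2005, §3 Thm. 3.4 and Lemma 3.8] [cite: Fukuda1994, Thm. 1 (2), p. 264]
[cite: Serre1972, §2.4 Prop. 15, §5.3] [cite: Cremona2006, Table 1 (Cremona label 114075cr1)] -/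
theorem conjA_g114075cr1_3_L8r
    {W : WeierstrassCurve ℚ} [W.IsElliptic] (hWeq : W = (⟨0, 0, 1, (-1755), (-28519)⟩ : WeierstrassCurve ℚ))
    (P : ↥(W.geomTorsion ((3 : ℕ) : ℤ))) (hP0 : P ≠ 0)
    (hrk : ∀ κP : ZpExtension ↥(fixedField (MulAction.stabilizer (absoluteGaloisGroup ℚ) P) :
        IntermediateField ℚ (AlgebraicClosure ℚ)) 3, κP.IsCyclotomic →
        classGroupPRank κP (0 + 1) = classGroupPRank κP 0)
    (κ : ZpExtension ℚ 3) (hκ : κ.IsCyclotomic) :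
    ∃ (γ : absoluteGaloisGroup ℚ) (Df : W.FineSelmerDualData κ γ),
      Module.Finite ℤ_[3] (RestrictScalars ℤ_[3] (IwasawaAlgebra 3) Df.X) := by
  subst hWeq
  exact conjA_three_of_Δ_eq_cube_of_classGroupPRank_stabilizerField_succ_eq _ irr_g114075cr1_3 WildFineSelmerLayerOneL5Records.Δ_cube_g114075cr1 P hP0 0 hrk κ hκ

/-- **RECORD — U₀ `ord₃ #Ш(E) ≤ ord₃ #Ш(E)_an` for `E = 114075cr1` at `p = 3` on the fact-free door L8.3 / Fukuda RANK test at `ℚ(P)`** (U₀-ns row of K9 items 19189 / 19197):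
KERNEL `classO6_g114075cr1_3`, `irr_g114075cr1_3`, `Δ_cube_g114075cr1`; DISPLAYED named facts `hKatoA hGZK hmod` ONLY, Cremona's `r_an = 0` (`hr`), and `hrk` (kit j336045:
`Cl(ℚ(P)) ≅ [4]` CERT, `Cl(ℚ(P)₁) ≅ [4]` GRH). Per row; nothing booked; BSD is not proved by this.
[cite: Kato2004Asterisque, Thm. 14.5 (3) (p. 236) and Prop. 14.16 (2)] [cite: CoatesSujatha2005, §3 Thm. 3.4] [cite: Fukuda1994, Thm. 1 (2), p. 264]
[cite: Cremona2006, Table 1 (Cremona label 114075cr1)] -/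
theorem missingUpperBoundAt_g114075cr1_3_L8r
    (hKatoA : Kato2004.rankZero_padicValNat_sha_add_padicValNat_tamagawa_le_of_additive_potGood_of_irreducible_of_fineSelmerDual_fg)
    (hGZK : rank_eq_analyticRank_of_analyticRank_le_one) (hmod : hasEntireLFunction_rat)
    {W : WeierstrassCurve ℚ} [W.IsElliptic] [W.IsGloballyMinimal] (hWeq : W = (⟨0, 0, 1, (-1755), (-28519)⟩ : WeierstrassCurve ℚ))
    (hr : W.analyticRank = 0) (P : ↥(W.geomTorsion ((3 : ℕ) : ℤ))) (hP0 : P ≠ 0)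
    (hrk : ∀ κP : ZpExtension ↥(fixedField (MulAction.stabilizer (absoluteGaloisGroup ℚ) P) :
        IntermediateField ℚ (AlgebraicClosure ℚ)) 3, κP.IsCyclotomic →
        classGroupPRank κP (0 + 1) = classGroupPRank κP 0) :
    MissingUpperBoundAt W 3 := by
  subst hWeq
  exact missingUpperBoundAt_three_of_Δ_eq_cube_of_classGroupPRank_stabilizerField_succ_eq hKatoA hGZK hmod _ hr classO6_g114075cr1_3 irr_g114075cr1_3
    WildFineSelmerLayerOneL5Records.Δ_cube_g114075cr1 P hP0 0 hrk

/-! ### `114075cu1` @ `p = 3` — `N = 114075 = 3^3·5^2·13^2`; Cremona: `r_an = 0`; O6 wild at `3`; image `3Nn` (census); `Δ = (-296595)³`; torsion-point field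
`ℚ(P) ≅ ℚ[x]/(x^8 - 12*x^6 - 65*x^5 - 141*x^4 - 195*x^3 - 108*x^2 + 81)` (octic, kit j336045 rebuilt from `ψ₃`; `h = 4`, `Cl ≅ [4]`, `bnfcertify = 1`: CERTIFIED; primes above `3` `[e,f] = [[1, 1], [2, 1], [2, 1], [2, 1], [1, 1]]`);
first cyclotomic layer `ℚ(P)₁ = ℚ(P)·ℚ(ζ₉)⁺` (degree 24; kit j336045, GRH: `h = 4`, `Cl ≅ [4]`, primes above `3` `[[3, 1], [6, 1], [6, 1], [6, 1], [3, 1]]`; `bnfcertify` NOT finished in the 3 h cap):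
`rank₃ Cl(ℚ(P)) = 0` (CERT) `= 0 = rank₃ Cl(ℚ(P)₁)` (GRH) — Fukuda's RANK test holds at `(0,1)` (the ORDER test too: `ord₃ h` 0 = 0).
Earlier fact-free (A) roads of this row all read a degree-48 field `L₁ = ℚ(E[3])·ℚ(ζ₉)⁺` under GRH (`…FukudaRecordsNoF`, `…LayerOneL5Records09`); this record reads degree 8 (certified) + degree 24 (GRH). -/
/-- **(A) AT `(114075cu1, 3)` — NO NAMED FACT** (door L8.3, Fukuda RANK test at `ℚ(P)`, layers `(0,1)`): KERNEL `irr_g114075cu1_3`, `Δ_cube_g114075cu1`; DISPLAYED `hrk`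
(«`rank₃ Cl(ℚ(P)₁) = rank₃ Cl(ℚ(P))`», every `P ≠ 0`, every cyclotomic `κ_P`; kit j336045: `Cl(ℚ(P)) ≅ [4]` CERTIFIED, `Cl(ℚ(P)₁) ≅ [4]` GRH, ranks `0 = 0`).
Per row; CONDITIONAL on the displayed datum; nothing booked; (A)/BSD proved for no class. [cite: CoatesSujatha2005, §3 Thm. 3.4 and Lemma 3.8] [cite: Fukuda1994, Thm. 1 (2), p. 264]
[cite: Serre1972, §2.4 Prop. 15, §5.3] [cite: Cremona2006, Table 1 (Cremona label 114075cu1)] -/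
theorem conjA_g114075cu1_3_L8r
    {W : WeierstrassCurve ℚ} [W.IsElliptic] (hWeq : W = (⟨0, 0, 1, (-296595), (-62655694)⟩ : WeierstrassCurve ℚ))
    (P : ↥(W.geomTorsion ((3 : ℕ) : ℤ))) (hP0 : P ≠ 0)
    (hrk : ∀ κP : ZpExtension ↥(fixedField (MulAction.stabilizer (absoluteGaloisGroup ℚ) P) :
        IntermediateField ℚ (AlgebraicClosure ℚ)) 3, κP.IsCyclotomic →
        classGroupPRank κP (0 + 1) = classGroupPRank κP 0)
    (κ : ZpExtension ℚ 3) (hκ : κ.IsCyclotomic) :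
    ∃ (γ : absoluteGaloisGroup ℚ) (Df : W.FineSelmerDualData κ γ),
      Module.Finite ℤ_[3] (RestrictScalars ℤ_[3] (IwasawaAlgebra 3) Df.X) := by
  subst hWeq
  exact conjA_three_of_Δ_eq_cube_of_classGroupPRank_stabilizerField_succ_eq _ irr_g114075cu1_3 WildFineSelmerLayerOneL5Records.Δ_cube_g114075cu1 P hP0 0 hrk κ hκ

/-- **RECORD — U₀ `ord₃ #Ш(E) ≤ ord₃ #Ш(E)_an` for `E = 114075cu1` at `p = 3` on the fact-free door L8.3 / Fukuda RANK test at `ℚ(P)`** (U₀-ns row of K9 items 19189 / 19197):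
KERNEL `classO6_g114075cu1_3`, `irr_g114075cu1_3`, `Δ_cube_g114075cu1`; DISPLAYED named facts `hKatoA hGZK hmod` ONLY, Cremona's `r_an = 0` (`hr`), and `hrk` (kit j336045:
`Cl(ℚ(P)) ≅ [4]` CERT, `Cl(ℚ(P)₁) ≅ [4]` GRH). Per row; nothing booked; BSD is not proved by this.
[cite: Kato2004Asterisque, Thm. 14.5 (3) (p. 236) and Prop. 14.16 (2)] [cite: CoatesSujatha2005, §3 Thm. 3.4] [cite: Fukuda1994, Thm. 1 (2), p. 264]
[cite: Cremona2006, Table 1 (Cremona label 114075cu1)] -/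
theorem missingUpperBoundAt_g114075cu1_3_L8r
    (hKatoA : Kato2004.rankZero_padicValNat_sha_add_padicValNat_tamagawa_le_of_additive_potGood_of_irreducible_of_fineSelmerDual_fg)
    (hGZK : rank_eq_analyticRank_of_analyticRank_le_one) (hmod : hasEntireLFunction_rat)
    {W : WeierstrassCurve ℚ} [W.IsElliptic] [W.IsGloballyMinimal] (hWeq : W = (⟨0, 0, 1, (-296595), (-62655694)⟩ : WeierstrassCurve ℚ))
    (hr : W.analyticRank = 0) (P : ↥(W.geomTorsion ((3 : ℕ) : ℤ))) (hP0 : P ≠ 0)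
    (hrk : ∀ κP : ZpExtension ↥(fixedField (MulAction.stabilizer (absoluteGaloisGroup ℚ) P) :
        IntermediateField ℚ (AlgebraicClosure ℚ)) 3, κP.IsCyclotomic →
        classGroupPRank κP (0 + 1) = classGroupPRank κP 0) :
    MissingUpperBoundAt W 3 := by
  subst hWeq
  exact missingUpperBoundAt_three_of_Δ_eq_cube_of_classGroupPRank_stabilizerField_succ_eq hKatoA hGZK hmod _ hr classO6_g114075cu1_3 irr_g114075cu1_3
    WildFineSelmerLayerOneL5Records.Δ_cube_g114075cu1 P hP0 0 hrk

/-! ### `181629r1` @ `p = 3` — `N = 181629 = 3^3·7·31^2`; Cremona: `r_an = 0`; O6 wild at `3`; image `3Nn` (census); `Δ = (-625611)³`; torsion-point field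
`ℚ(P) ≅ ℚ[x]/(x^8 - 2*x^7 + x^6 - 23*x^5 + 55*x^4 - 32*x^3 + 109*x^2 - 275*x + 163)` (octic, kit j336045 rebuilt from `ψ₃`; `h = 3`, `Cl ≅ [3]`, `bnfcertify = 1`: CERTIFIED; primes above `3` `[e,f] = [[8, 1]]`);
first cyclotomic layer `ℚ(P)₁ = ℚ(P)·ℚ(ζ₉)⁺` (degree 24; kit j336045, GRH: `h = 9`, `Cl ≅ [9]`, primes above `3` `[[24, 1]]`; `bnfcertify` NOT finished in the 3 h cap):
`rank₃ Cl(ℚ(P)) = 1` (CERT) `= 1 = rank₃ Cl(ℚ(P)₁)` (GRH) — Fukuda's RANK test holds at `(0,1)` (the order test FAILS: `ord₃ h` grows 1 → 2).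
Earlier fact-free (A) roads of this row all read a degree-48 field `L₁ = ℚ(E[3])·ℚ(ζ₉)⁺` under GRH (`…FukudaRecordsNoF`); this record reads degree 8 (certified) + degree 24 (GRH). -/
/-- `Δ(181629r1) = (-625611)³` — a CUBE (kernel, `norm_num`). [cite: Serre1972, §5.3] [cite: Cremona2006, Table 1 (Cremona label 181629r1)] -/
theorem Δ_cube_g181629r1 : (⟨0, 0, 1, 89373, 21471863⟩ : WeierstrassCurve ℚ).Δ = (((-625611) : ℚ)) ^ 3 := by
  norm_num [WeierstrassCurve.Δ, WeierstrassCurve.b₂, WeierstrassCurve.b₄, WeierstrassCurve.b₆, WeierstrassCurve.b₈]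

/-- **(A) AT `(181629r1, 3)` — NO NAMED FACT** (door L8.3, Fukuda RANK test at `ℚ(P)`, layers `(0,1)`): KERNEL `irr_g181629r1_3`, `Δ_cube_g181629r1`; DISPLAYED `hrk`
(«`rank₃ Cl(ℚ(P)₁) = rank₃ Cl(ℚ(P))`», every `P ≠ 0`, every cyclotomic `κ_P`; kit j336045: `Cl(ℚ(P)) ≅ [3]` CERTIFIED, `Cl(ℚ(P)₁) ≅ [9]` GRH, ranks `1 = 1`).
Per row; CONDITIONAL on the displayed datum; nothing booked; (A)/BSD proved for no class. [cite: CoatesSujatha2005, §3 Thm. 3.4 and Lemma 3.8] [cite: Fukuda1994, Thm. 1 (2), p. 264]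
[cite: Serre1972, §2.4 Prop. 15, §5.3] [cite: Cremona2006, Table 1 (Cremona label 181629r1)] -/
theorem conjA_g181629r1_3_L8r
    {W : WeierstrassCurve ℚ} [W.IsElliptic] (hWeq : W = (⟨0, 0, 1, 89373, 21471863⟩ : WeierstrassCurve ℚ))
    (P : ↥(W.geomTorsion ((3 : ℕ) : ℤ))) (hP0 : P ≠ 0)
    (hrk : ∀ κP : ZpExtension ↥(fixedField (MulAction.stabilizer (absoluteGaloisGroup ℚ) P) :
        IntermediateField ℚ (AlgebraicClosure ℚ)) 3, κP.IsCyclotomic →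
        classGroupPRank κP (0 + 1) = classGroupPRank κP 0)
    (κ : ZpExtension ℚ 3) (hκ : κ.IsCyclotomic) :
    ∃ (γ : absoluteGaloisGroup ℚ) (Df : W.FineSelmerDualData κ γ),
      Module.Finite ℤ_[3] (RestrictScalars ℤ_[3] (IwasawaAlgebra 3) Df.X) := by
  subst hWeq
  exact conjA_three_of_Δ_eq_cube_of_classGroupPRank_stabilizerField_succ_eq _ irr_g181629r1_3 Δ_cube_g181629r1 P hP0 0 hrk κ hκ

/-- **RECORD — U₀ `ord₃ #Ш(E) ≤ ord₃ #Ш(E)_an` for `E = 181629r1` at `p = 3` on the fact-free door L8.3 / Fukuda RANK test at `ℚ(P)`** (U₀-ns row of K9 items 19189 / 19197):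
KERNEL `classO6_g181629r1_3`, `irr_g181629r1_3`, `Δ_cube_g181629r1`; DISPLAYED named facts `hKatoA hGZK hmod` ONLY, Cremona's `r_an = 0` (`hr`), and `hrk` (kit j336045:
`Cl(ℚ(P)) ≅ [3]` CERT, `Cl(ℚ(P)₁) ≅ [9]` GRH). Per row; nothing booked; BSD is not proved by this.
[cite: Kato2004Asterisque, Thm. 14.5 (3) (p. 236) and Prop. 14.16 (2)] [cite: CoatesSujatha2005, §3 Thm. 3.4] [cite: Fukuda1994, Thm. 1 (2), p. 264]
[cite: Cremona2006, Table 1 (Cremona label 181629r1)] -/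
theorem missingUpperBoundAt_g181629r1_3_L8r
    (hKatoA : Kato2004.rankZero_padicValNat_sha_add_padicValNat_tamagawa_le_of_additive_potGood_of_irreducible_of_fineSelmerDual_fg)
    (hGZK : rank_eq_analyticRank_of_analyticRank_le_one) (hmod : hasEntireLFunction_rat)
    {W : WeierstrassCurve ℚ} [W.IsElliptic] [W.IsGloballyMinimal] (hWeq : W = (⟨0, 0, 1, 89373, 21471863⟩ : WeierstrassCurve ℚ))
    (hr : W.analyticRank = 0) (P : ↥(W.geomTorsion ((3 : ℕ) : ℤ))) (hP0 : P ≠ 0)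
    (hrk : ∀ κP : ZpExtension ↥(fixedField (MulAction.stabilizer (absoluteGaloisGroup ℚ) P) :
        IntermediateField ℚ (AlgebraicClosure ℚ)) 3, κP.IsCyclotomic →
        classGroupPRank κP (0 + 1) = classGroupPRank κP 0) :
    MissingUpperBoundAt W 3 := by
  subst hWeq
  exact missingUpperBoundAt_three_of_Δ_eq_cube_of_classGroupPRank_stabilizerField_succ_eq hKatoA hGZK hmod _ hr classO6_g181629r1_3 irr_g181629r1_3
    Δ_cube_g181629r1 P hP0 0 hrk

/-! ### `292032gn1` @ `p = 3` — `N = 292032 = 2^6·3^3·13^2`; Cremona: `r_an = 0`; O6 wild at `3`; image `3Nn` (census); `Δ = (-2028)³`; torsion-point field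
`ℚ(P) ≅ ℚ[x]/(x^8 - 8*x^7 - 50*x^6 + 340*x^5 + 1252*x^4 + 1708*x^3 + 8146*x^2 - 16496*x - 15551)` (octic, kit j336045 rebuilt from `ψ₃`; `h = 12`, `Cl ≅ [6, 2]`, `bnfcertify = 1`: CERTIFIED; primes above `3` `[e,f] = [[8, 1]]`);
first cyclotomic layer `ℚ(P)₁ = ℚ(P)·ℚ(ζ₉)⁺` (degree 24; kit j336045, GRH: `h = 12`, `Cl ≅ [6, 2]`, primes above `3` `[[24, 1]]`; `bnfcertify` NOT finished in the 3 h cap):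
`rank₃ Cl(ℚ(P)) = 1` (CERT) `= 1 = rank₃ Cl(ℚ(P)₁)` (GRH) — Fukuda's RANK test holds at `(0,1)` (the ORDER test too: `ord₃ h` 1 = 1).
Earlier fact-free (A) roads of this row all read a degree-48 field `L₁ = ℚ(E[3])·ℚ(ζ₉)⁺` under GRH (`…FukudaRecordsNoF`); this record reads degree 8 (certified) + degree 24 (GRH). -/
/-- `Δ(292032gn1) = (-2028)³` — a CUBE (kernel, `norm_num`). [cite: Serre1972, §5.3] [cite: Cremona2006, Table 1 (Cremona label 292032gn1)] -/
theorem Δ_cube_g292032gn1 : (⟨0, 0, 0, (-1014), (-13182)⟩ : WeierstrassCurve ℚ).Δ = (((-2028) : ℚ)) ^ 3 := by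
  norm_num [WeierstrassCurve.Δ, WeierstrassCurve.b₂, WeierstrassCurve.b₄, WeierstrassCurve.b₆, WeierstrassCurve.b₈]

/-- **(A) AT `(292032gn1, 3)` — NO NAMED FACT** (door L8.3, Fukuda RANK test at `ℚ(P)`, layers `(0,1)`): KERNEL `irr_g292032gn1_3`, `Δ_cube_g292032gn1`; DISPLAYED `hrk`
(«`rank₃ Cl(ℚ(P)₁) = rank₃ Cl(ℚ(P))`», every `P ≠ 0`, every cyclotomic `κ_P`; kit j336045: `Cl(ℚ(P)) ≅ [6, 2]` CERTIFIED, `Cl(ℚ(P)₁) ≅ [6, 2]` GRH, ranks `1 = 1`).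
Per row; CONDITIONAL on the displayed datum; nothing booked; (A)/BSD proved for no class. [cite: CoatesSujatha2005, §3 Thm. 3.4 and Lemma 3.8] [cite: Fukuda1994, Thm. 1 (2), p. 264]
[cite: Serre1972, §2.4 Prop. 15, §5.3] [cite: Cremona2006, Table 1 (Cremona label 292032gn1)] -/
theorem conjA_g292032gn1_3_L8r
    {W : WeierstrassCurve ℚ} [W.IsElliptic] (hWeq : W = (⟨0, 0, 0, (-1014), (-13182)⟩ : WeierstrassCurve ℚ))
    (P : ↥(W.geomTorsion ((3 : ℕ) : ℤ))) (hP0 : P ≠ 0)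
    (hrk : ∀ κP : ZpExtension ↥(fixedField (MulAction.stabilizer (absoluteGaloisGroup ℚ) P) :
        IntermediateField ℚ (AlgebraicClosure ℚ)) 3, κP.IsCyclotomic →
        classGroupPRank κP (0 + 1) = classGroupPRank κP 0)
    (κ : ZpExtension ℚ 3) (hκ : κ.IsCyclotomic) :
    ∃ (γ : absoluteGaloisGroup ℚ) (Df : W.FineSelmerDualData κ γ),
      Module.Finite ℤ_[3] (RestrictScalars ℤ_[3] (IwasawaAlgebra 3) Df.X) := by
  subst hWeq
  exact conjA_three_of_Δ_eq_cube_of_classGroupPRank_stabilizerField_succ_eq _ irr_g292032gn1_3 Δ_cube_g292032gn1 P hP0 0 hrk κ hκ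

/-- **RECORD — U₀ `ord₃ #Ш(E) ≤ ord₃ #Ш(E)_an` for `E = 292032gn1` at `p = 3` on the fact-free door L8.3 / Fukuda RANK test at `ℚ(P)`** (U₀-ns row of K9 items 19189 / 19197):
KERNEL `classO6_g292032gn1_3`, `irr_g292032gn1_3`, `Δ_cube_g292032gn1`; DISPLAYED named facts `hKatoA hGZK hmod` ONLY, Cremona's `r_an = 0` (`hr`), and `hrk` (kit j336045:
`Cl(ℚ(P)) ≅ [6, 2]` CERT, `Cl(ℚ(P)₁) ≅ [6, 2]` GRH). Per row; nothing booked; BSD is not proved by this.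
[cite: Kato2004Asterisque, Thm. 14.5 (3) (p. 236) and Prop. 14.16 (2)] [cite: CoatesSujatha2005, §3 Thm. 3.4] [cite: Fukuda1994, Thm. 1 (2), p. 264]
[cite: Cremona2006, Table 1 (Cremona label 292032gn1)] -/
theorem missingUpperBoundAt_g292032gn1_3_L8r
    (hKatoA : Kato2004.rankZero_padicValNat_sha_add_padicValNat_tamagawa_le_of_additive_potGood_of_irreducible_of_fineSelmerDual_fg)
    (hGZK : rank_eq_analyticRank_of_analyticRank_le_one) (hmod : hasEntireLFunction_rat)
    {W : WeierstrassCurve ℚ} [W.IsElliptic] [W.IsGloballyMinimal] (hWeq : W = (⟨0, 0, 0, (-1014), (-13182)⟩ : WeierstrassCurve ℚ))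
    (hr : W.analyticRank = 0) (P : ↥(W.geomTorsion ((3 : ℕ) : ℤ))) (hP0 : P ≠ 0)
    (hrk : ∀ κP : ZpExtension ↥(fixedField (MulAction.stabilizer (absoluteGaloisGroup ℚ) P) :
        IntermediateField ℚ (AlgebraicClosure ℚ)) 3, κP.IsCyclotomic →
        classGroupPRank κP (0 + 1) = classGroupPRank κP 0) :
    MissingUpperBoundAt W 3 := by
  subst hWeq
  exact missingUpperBoundAt_three_of_Δ_eq_cube_of_classGroupPRank_stabilizerField_succ_eq hKatoA hGZK hmod _ hr classO6_g292032gn1_3 irr_g292032gn1_3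
    Δ_cube_g292032gn1 P hP0 0 hrk

end Summit.BirchSwinnertonDyer.BirchSwinnertonDyer.Theorems.WildFineSelmerStabilizerFukudaRecords

end
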